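import Mathlib
import HarnessLib
import Summits.ResolutionOfSingularities.ResolutionOfSingularities.Theorems.WildQuotientsWildQuotientResolutionS1aSymMember
import Summits.ResolutionOfSingularities.ResolutionOfSingularities.Theorems.WildQuotientsWildQuotientResolutionS1aNodePowerChains

/-!
# S1a — THE MEMBER OF THE PARALLEL KILL LEAF for a component cut out by ANY K1′ element `φ` of an abstract model (line components of the class `L_d`)

[OURS · L1 W4.5c · lead-1 g15; R3 (`lines_killsIn_two`): ✓`exists_isPrincipalCentre_of_symMember` (`…S1aSymMember`, component = a VARIABLE of the free model)
restated for an ABSTRACT model `Φ : DW.B ≃ P` and an arbitrary component element `φ` with K1′ of `(X₀, φ)` supplied — through the abstract producer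
✓`exists_isPrincipalCentre_of_nodePowerChains`; the algebra is ✓`symMember_admissible/isolation/chains` verbatim] — NOT statements of the manuscript; counted
0; AI-level work, weaker than expert review. Crux stmt-ResolutionOfSingularities-17941 `CyclicQuotientFourfolds`, line `s1a-logminvertex` v13 (`stub_reachLowerInFX`).

* ★★★ `exists_isPrincipalCentre_of_symMemberK1` — rows of a (re-coordinated) symmetric-root chart on generators `s, X₀, X₁, X₂, x₃` (+ fixed `Gfix`) of `P`,
  a component `φ ∈ P` with `τφ = φ + c·s^δX₀` (`c ≠ 0`), tail `T = H·φ` (`H` a unit), K1′ for `(X₀, φ)`, degrees, a GIVEN Veronese degree and separating sections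
  ⇒ a PRINCIPAL centre of that degree with `W` a principal-centre chart, `supp ⊆ W`, `supp` disjoint from the separating opens, and the trace formula on `W`.
-/

set_option linter.dupNamespace false

noncomputable section

open CategoryTheory Limits AlgebraicGeometry TopologicalSpace Topology Opposite
open Literature.AlgebraicGeometry.Resolution Literature.AlgebraicGeometry.RelativeSpec
open MvPolynomial
open Summit.ResolutionOfSingularities.ResolutionOfSingularities.Theorems.WildQuotientResolution.S1
open Summit.ResolutionOfSingularities.ResolutionOfSingularities.Theorems.WildQuotientResolution.S1.NodeAtlas
open Summit.ResolutionOfSingularities.ResolutionOfSingularities.Theorems.WildQuotientResolution.S1.ProducerStep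
open Summit.ResolutionOfSingularities.ResolutionOfSingularities.Theorems.WildQuotientResolution.S1.CoarseChart
open Summit.ResolutionOfSingularities.ResolutionOfSingularities.Theorems.WildQuotientResolution.S1.GoodCharts
open Summit.ResolutionOfSingularities.ResolutionOfSingularities.Theorems.WildQuotientResolution.S1.NodeTransport
open Summit.ResolutionOfSingularities.ResolutionOfSingularities.Theorems.WildQuotientResolution.S1.NpFrame
open Summit.ResolutionOfSingularities.ResolutionOfSingularities.Theorems.WildQuotientResolution.S1.KillCert
open Summit.ResolutionOfSingularities.ResolutionOfSingularities.Theorems.WildQuotientResolution.S1.BlowupCharts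

namespace Summit.ResolutionOfSingularities.ResolutionOfSingularities.Theorems.WildQuotientResolution.S1.GameFrame.GModel

variable {p : ℕ} {X' X₁ : Scheme.{0}} {q : X' ⟶ X₁} {G : Type} [Group G] {ρ : G →* Aut X'} {g₀ : G}

set_option maxHeartbeats 1600000 in
/-- ★★★ **THE MEMBER OF THE PARALLEL KILL LEAF, abstract model and K1′ component.** See the module docstring.
[OURS · L1 W4.5c · R3 member (line components); NOT a statement of the manuscript] -/
theorem exists_isPrincipalCentre_of_symMemberK1 [Finite G] (hG : ∀ g : G, g ∈ Subgroup.zpowers g₀) (M : GModel p q G ρ g₀)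
    [M.V.IsSeparated] (W : M.act.StableAffineOpens) (DW : NodeData p M.act g₀ W)
    {k : Type} [Field k] {P : Type} [CommRing P] [Algebra k P] (Φ : letI := DW.instCommRing; DW.B ≃+* P)
    (τ : P ≃+* P) (hτ : letI := DW.instCommRing; ∀ x, τ x = Φ (DW.σ (Φ.symm x)))
    (s X₀ X₁ X₂ x₃ φ T H : P) (c₁ c₂ c : k) (δ : ℕ) (Gfix : Set P)
    (hs : τ s = s) (hX₀ : τ X₀ = X₀) (hX₁ : τ X₁ = X₁ + algebraMap k P c₁ * (s ^ δ * X₀)) (hX₂ : τ X₂ = X₂ + algebraMap k P c₂ * (s ^ δ * X₀))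
    (hx₃ : τ x₃ = x₃ + s ^ δ * T) (hφ : τ φ = φ + algebraMap k P c * (s ^ δ * X₀)) (hc : c ≠ 0) (hXR : T = H * φ) (hH : IsUnit H)
    (hfix : ∀ g ∈ Gfix, τ g = g) (hgen : Subring.closure (({s, X₀, X₁, X₂, x₃} : Set P) ∪ Gfix) = ⊤)
    (hK1 : RingTheory.Sequence.IsRegular P (List.ofFn (![X₀, φ] : Fin 2 → P))) (hK1' : IsRegularRing (P ⧸ Ideal.span (Set.range (![X₀, φ] : Fin 2 → P))))
    (θ₀ θ₁ : Π j : Fin DW.m, ZMod (DW.r j))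
    (hX₀d : letI := DW.instCommRing; letI := DW.instGradedRing; X₀ ∈ mapGrading DW.𝒜 Φ θ₀)
    (hφd : letI := DW.instCommRing; letI := DW.instGradedRing; φ ∈ mapGrading DW.𝒜 Φ θ₁)
    (d : ℕ) (hd : 0 < d)
    (hver : letI := DW.instCommRing; letI := DW.instGradedRing; letI := mapGradedRing DW.𝒜 Φ; VeroneseNormalised (mapGrading DW.𝒜 Φ) (![X₀, φ] : Fin 2 → P) ![2, 1] d)
    {κ : Type} (U : κ → M.V.Opens) (hcov : ∀ x : M.V, x ∈ W.1 ∨ ∃ i, x ∈ U i) (u : κ → Γ(M.V, W.1)) (nu : κ → ℕ) (hnu : ∀ i, 0 < nu i)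
    (huJ : letI := DW.instCommRing; letI := DW.instGradedRing; ∀ i,
      Φ ((DW.e (u i) : ↥(DW.𝒜 0)) : DW.B) ∈ (weightedFiltration (![X₀, φ] : Fin 2 → P) ![2, 1]).ideal (nu i))
    (huU : ∀ i, ∀ x ∈ W.1, x ∈ U i → x ∈ M.V.basicOpen (u i)) :
    letI := DW.instCommRing; letI := DW.instGradedRing; letI := mapGradedRing DW.𝒜 Φ
    ∃ J : ReesFiltration M.V, IsPrincipalCentre p M.act g₀ J d ∧ IsPrincipalCentreChart p M.act g₀ J d W ∧
      (((J.ideal d).support : Set M.V)) ⊆ (W.1 : Set M.V) ∧ (∀ i, Disjoint ((U i : Set M.V)) (((J.ideal d).support : Set M.V))) ∧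
      ∀ n, (J.filtration ⟨W.1, DW.affine⟩).ideal n =
        ((traceFiltration (mapGrading DW.𝒜 Φ) (![X₀, φ] : Fin 2 → P) ![2, 1]).ideal n).comap
          ((DW.e.trans (zeroRingEquiv DW.𝒜 Φ) : Γ(M.V, W.1) ≃+* ↥(mapGrading DW.𝒜 Φ 0)) : Γ(M.V, W.1) →+* ↥(mapGrading DW.𝒜 Φ 0)) := by
  classical
  letI := DW.instCommRing
  letI := DW.instGradedRing
  letI := mapGradedRing DW.𝒜 Φ
  have hτeq : (conj Φ DW.σ : P ≃+* P) = τ := RingEquiv.ext fun x => (hτ x).symm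
  -- the algebra of the member
  have hadm := Sym.symMember_admissible τ s X₀ X₁ X₂ x₃ φ T H c₁ c₂ c δ Gfix hs hX₀ hX₁ hX₂ hx₃ hφ hXR hfix hgen
  have hiso := Sym.symMember_isolation τ s X₀ x₃ φ T H c δ hx₃ hφ hXR hc hH
  have hchain := Sym.symMember_chains τ s X₀ x₃ φ T H c δ hx₃ hφ hXR hc hH
  rw [← hτeq] at hadm hiso hchain
  have hJmem : ∀ i, ∃ n : ℕ, 0 < n ∧ u i ^ n ∈ (((traceFiltration (mapGrading DW.𝒜 Φ) (![X₀, φ] : Fin 2 → P) ![2, 1]).ideal d).comap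
      ((DW.e.trans (zeroRingEquiv DW.𝒜 Φ) : Γ(M.V, W.1) ≃+* ↥(mapGrading DW.𝒜 Φ 0)) : Γ(M.V, W.1) →+* ↥(mapGrading DW.𝒜 Φ 0)) : Ideal Γ(M.V, W.1)) := by
    intro i
    refine ⟨d, hd, ?_⟩
    change (DW.e.trans (zeroRingEquiv DW.𝒜 Φ)) (u i ^ d) ∈ (traceFiltration (mapGrading DW.𝒜 Φ) (![X₀, φ] : Fin 2 → P) ![2, 1]).ideal d
    rw [mem_traceFiltration_iff, map_pow, SetLike.GradeZero.coe_pow]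
    change (Φ ((DW.e (u i) : ↥(DW.𝒜 0)) : DW.B)) ^ d ∈ _
    have h := Ideal.pow_mem_pow (huJ i) d
    have hle := Veronese.idealFiltration_pow_le (weightedFiltration (![X₀, φ] : Fin 2 → P) ![2, 1]) (nu i) d
    exact (weightedFiltration (![X₀, φ] : Fin 2 → P) ![2, 1]).antitone (Nat.le_mul_of_pos_left d (hnu i)) (hle h)
  have hcl : closure (M.V.zeroLocus (U := W.1)
      ((((traceFiltration (mapGrading DW.𝒜 Φ) (![X₀, φ] : Fin 2 → P) ![2, 1]).ideal d).comap
          ((DW.e.trans (zeroRingEquiv DW.𝒜 Φ) : Γ(M.V, W.1) ≃+* ↥(mapGrading DW.𝒜 Φ 0)) : Γ(M.V, W.1) →+* ↥(mapGrading DW.𝒜 Φ 0)) :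
        Ideal Γ(M.V, W.1)) : Set Γ(M.V, W.1)) ∩ (W.1 : Set M.V)) ⊆ (W.1 : Set M.V) :=
    closure_zeroLocus_inter_subset_of_cover W.1 U hcov _ u (fun i => (hJmem i).imp fun n hn => ⟨hn.1, hn.2⟩) huU
  obtain ⟨J, hJ, hJW, hJsupp, hJfil⟩ := exists_isPrincipalCentre_of_nodePowerChains hG M W DW Φ two_pos (![X₀, φ] : Fin 2 → P) ![θ₀, θ₁] ![2, 1]
    (fun i => by fin_cases i <;> norm_num) (fun i => by fin_cases i <;> assumption) hK1 hK1' d hd hver (s ^ δ) 1 hadm hiso hchain hcl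
  refine ⟨J, hJ, hJW, hJsupp.trans hcl, fun i => ?_, hJfil⟩
  obtain ⟨n, hn, hnS⟩ := hJmem i
  exact Disjoint.mono_right hJsupp (disjoint_closure_zeroLocus_of_section W.1 (U i) _ (u i) hn hnS (huU i))

end Summit.ResolutionOfSingularities.ResolutionOfSingularities.Theorems.WildQuotientResolution.S1.GameFrame.GModel

end
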